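import Literature.IUT.HodgeArakelov.FlSymmetryConjQuotientActions
import Literature.IUT.HodgeArakelov.TwoSectionsCommutatorPin
import Literature.IUT.HodgeArakelov.CoreTowerGenuinePinned
import Literature.IUT.HodgeArakelov.FlSymmetryModelAbelian
import HarnessLib

/-!
# [IUTchII] Rmk. 1.1.1 (iv) at the GENUINE [EtTh] frame: the `𝔽_l^{⋊±}`-symmetry record `FlSymmetry Sec` WITH THE
# CONJUGATION ACTIONS — the commutator map `[-,-]` IS `Π_C(M)`-EQUIVARIANT (GAP row G-w4d018-1 CLOSED, part 4/4)

Mochizuki, *Inter-universal Teichmüller theory II*, §1, Remark 1.1.1 (iv), kurims manuscript (Dec. 2020) p. 23 l. 11–49,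
p. 24 l. 1–3 [claim: Mochizuki2012, status: disputed] (IUTchII §1 Rmk 1.1.1 (iv), kurims pp.23-24): «one may regard the
commutator map of (iii) as a map `[-,-] : (Δ_X(M^Θ)/Δ_Y(M^Θ)) × Δ^ell_Y(M^Θ) → Π_{M^Θ}|_{(l·Δ_Θ)(M^Θ)}` for which both
the domain and the codomain are equipped with natural actions by `Π_C(M^Θ)`. Now one verifies easily that this commutator
map is equivariant with respect to these natural actions by `Π_C(M^Θ)`, and, moreover, that the various subgroups …
constructed in (iii) are stabilized by the natural action by `Π_C(M^Θ)` … hence, in particular, by the natural action by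
`(Π_C(M^Θ) ⊇) Δ_C(M^Θ) ↠ Δ_C(M^Θ)/Δ_X(M^Θ) ⥲ 𝔽_l^{⋊±}`»; [EtTh] §2 p. 36, Prop. 2.12 (i) p. 45, Cor. 2.19 (i) p. 64
[cite: MochizukiEtTh2009, Cor 2.19(i) p.64].

abc-iut cell, layer L6, seat abc-iut-w4-d035 (gen 11), GAP-LEDGER row **G-w4d018-1** «FLSYMMETRY-GENUINE-EQUIVARIANCE»
(sub-row of G-w4d043-2; NODES IUTchII:Rmk1.1.1(iv) (iv)-C residual of record), PROOF-ONLY (0 `def`/`structure`/`instance`).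
Until now the typed record `FlSymmetry Sec` (abc-iut-L6-t1, `MonoThetaSymmetries`) was inhabited at the genuine frame only
with DEGENERATE action data (trivial actions: abc-iut-w5-d219 `FlSymmetry.nonempty_of`, abc-iut-w4-d019 p442142); abc-iut-
w4-d018 (p459254, p460635) constructed THE conjugation action `act` on `Π_M|_{(l·Δ_Θ)(M)}` and proved `act_factors`,
`sTheta_stable`, `sAlg_stable` for it. THIS FILE assembles **`ModelFrame.exists_flSymmetry_conj_genuine`**: at the [EtTh] model
frame (abc-iut-L6-d6's `F.reconstruction e` over abc-iut-L2-t8's `C.rigidData μ hC hS h15 L`, C-level record `cl` of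
abc-iut-L2-d3), there are the genuine core tower `W` (abc-iut-w4-d018's PINNED tower p466913 `exists_coreTower_pinned_of_cLevelData`,
BY NAME: `W.PiC = Π^tp_C` with identification `j`, `Δ_C(M) = Ker(augC ∘ j)`), the model theta-quotient datum `T`, the pinned two-sections datum
`Sec` (this seat's p465659, (P3) = the commutator pin) and a record **`Φ : FlSymmetry Sec` whose THREE action fields are the
CONJUGATION actions**: `Φ.act` = p459254's (pin: `μ_N`-coordinate through `galMuN ∘ augC`, `Π^tp_{Y̲̲}`-coordinate through
`conjX`), `Φ.actlZ` = the `±1` action on `(l·ℤ)(M)` read through `toZ`, `Φ.actEll` = conjugation on `Δ^ell_Y(M)` read through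
`(Π^tp_X)^ell` (this seat's p467696) — so that the field `commutator_equivariant` is **the printed equivariance clause for
the genuine actions**. Its proof: by (P3) and abc-iut-w4-d018's `conjAct_mk_sAlg`, both sides are classes of
`e⁻¹(s^alg(·))` at `x′ b′ x′⁻¹ b′⁻¹` (lifts of the moved classes) resp. `conjX c (x b x⁻¹ b⁻¹)`; the two have the same
image in `(Π^tp_X)^Θ` by this seat's PAIRING LEMMA (p466260 `toTheta_conjComm_eq_of_toZ_eq_of_thetaToEll_eq`: `θ[x,b]`
depends only on `(toZ x, toEll b)`; `(Δ^tp_Y)^Θ` abelian + `Δ_Θ` central) applied to the pins of `actlZ`/`actEll`, hence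
the same class (`envAtTheta_mk_eq_of_toTheta_eq`). Remaining fields BY NAME: `abelian` = abc-iut-w5-d219/w4-d019
`envAtTheta_mul_comm`, `deltaX_normal`/`quot_iso_Fl` = p466913's `𝔽_l^{⋊±}` clauses (`hlS : S.l = l`).
BINDER CENSUS (BY NAME, no `Prop` fact introduced, no FACT-LIST row consumed): `cl`, census C4 `cl.InvActsByNegOnEll`,
`IsEtThOrigin`, `hYcl`, the (R1c) clause `hR1c`, `hker` (abc-iut-w5-d165), `hlS`, `l` prime, a theta cocycle `η`.
HONEST FRAMING: kernel facts about the cell's own typed interfaces and model; constructed ≠ endorsed; Rmk. 1.1.1 is outside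
the [IUTchIII] Cor. 3.12 cone; no side taken on Cor. 3.12; typed ≠ proved; nothing here asserts abc proved or refuted.
-/

noncomputable section

namespace Literature.IUT.HodgeArakelov

open Literature.AnabelianGeometry.EtaleTheta Literature.AnabelianGeometry.SemiGraphs
open scoped Literature.AnabelianGeometry.EtaleTheta

namespace ModelFrame

variable {p : ℕ} [Fact p.Prime] {Mt : MuTwoSetting p}
  {E : Mt.toThetaSetting.EtaleThetaData} {l : ℕ} (C : E.DoubleUnderline l)
  {S : ThetaSetting.{0}} (μ : Mt.toThetaSetting.CyclotomeMod l S.N)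
  (hC : Mt.toThetaSetting.Compat) (hS : Mt.toThetaSetting.Sec2Hyps)
  (h15 : ThetaSetting.Prop15iii E hC) (L : C.CuspLabels)
  (F : ModelFrame S (C.rigidData μ hC hS h15 L)) {Menv : MonoThetaEnv S}
  (e : Menv.Pi ≃ₜ* (C.rigidData μ hC hS h15 L).env) (cl : Mt.CLevelData)

/-- **IUTchII:Rmk1.1.1(iv) — `FlSymmetry` WITH THE CONJUGATION ACTIONS at the genuine [EtTh] frame; the commutator map is
`Π_C(M)`-equivariant.** There are the genuine core tower `W` (p466913: `W.PiC = Π^tp_C`, identification `ω`; `Δ_C(M) = Ker(augC ∘ ω)`),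
the model theta-quotient datum `T`, a two-sections datum `Sec` with the commutator pin (P3), and `Φ : FlSymmetry Sec` with:
`Φ.act` pinned as conjugation read through the model embedding (and trivial on `Ker(augC)`), `Φ.actlZ` pinned through `toZ`
(`= 1` on `Π^tp_X`, inversion off it), `Φ.actEll` pinned through `(Π^tp_X)^ell`; `Φ.commutator_equivariant` is then the
printed clause «this commutator map is equivariant with respect to these natural actions by `Π_C(M^Θ)`» FOR THE GENUINE
ACTIONS. Inputs BY NAME: C4, `IsEtThOrigin`, `hYcl`, (R1c), `hker`, `hlS`, `l` prime, `η`.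
[claim: Mochizuki2012, status: disputed] (IUTchII §1 Rmk 1.1.1 (iv), kurims pp.23-24) -/
theorem exists_flSymmetry_conj_genuine (hinv : cl.InvActsByNegOnEll) (hO : Mt.toThetaSetting.IsEtThOrigin)
    (hYcl : (Mt.DtpY.map Mt.toHat.toMonoidHom).topologicalClosure ≤
      Mt.DtpY.map Mt.toHat.toMonoidHom ⊔ (⁅⁅Mt.DeltaHat, Mt.DeltaHat⁆, Mt.DeltaHat⁆).topologicalClosure)
    (hR1c : ∀ x : Mt.PiTemp, Mt.toZ (cl.conjX Mt.epsPM x) = (Mt.toZ x)⁻¹)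
    (hker : Mt.toTheta.ker ≤ C.Huu) (hlS : S.l = l) (hl : l.Prime)
    {η : (C.rigidData μ hC hS h15 L).PiYdd → (C.rigidData μ hC hS h15 L).mu}
    (hη : η ∈ (C.rigidData μ hC hS h15 L).thetaCocycles) :
    ∃ (W : CoreTower (F.reconstruction e)) (T : ThetaQuotientData (F.reconstruction e)) (Sec : TwoSections T W)
      (Φ : FlSymmetry Sec) (ω : W.PiC ≃* Mt.GtpC),
      W.PiC = TopGroup.of Mt.GtpC ∧
      W.kerEll = ((Mt.thetaToEll.comp Mt.toTheta).ker).comap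
        (C.Huu.subtype.comp (Mt.GtpY.subgroupOf C.Huu).subtype) ∧
      (∀ x : ↥C.Huu, ω ((W.isoXbarbar x : ↥W.Xbarbar) : W.PiC) = Mt.inclX (x : Mt.PiTemp)) ∧
      (∀ c : W.PiC, c ∈ W.Xbar ↔ ω c ∈ Mt.inclX.range) ∧
      (∀ c : W.PiC, c ∈ W.X ↔ ω c ∈ ((Subgroup.zpowers (Multiplicative.ofAdd (l : ℤ))).comap Mt.toZ).map Mt.inclX) ∧
      (∀ c : W.PiC, c ∈ W.DeltaC ↔ cl.augC (ω c) = 1) ∧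
      T.thetaSection = (((C.rigidData μ hC hS h15 L).thetaKer.subgroupOf (C.rigidData μ hC hS h15 L).PiY).map
          (CycEnvelope.algSection (C.rigidData μ hC hS h15 L).augY (C.rigidData μ hC hS h15 L).chi)).comap
          e.toMulEquiv.toMonoidHom ∧
      -- (P3) the commutator map of `Sec` is the genuine one
      (∀ (x : ↥C.Huu) (_hx : Mt.aug (x : Mt.PiTemp) = 1) (b : ↥(F.reconstruction e).DeltaY),
        ∃ (hmem : x * ((b : ↥(Mt.GtpY.subgroupOf C.Huu)) : ↥C.Huu) * x⁻¹ *
              (((b : ↥(Mt.GtpY.subgroupOf C.Huu)) : ↥C.Huu))⁻¹ ∈ (C.rigidData μ hC hS h15 L).lDeltaTheta)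
          (hg : e.symm ((C.rigidData μ hC hS h15 L).toThetaEnvData.sAlg
            ⟨((⟨_, hmem⟩ : ↥(C.rigidData μ hC hS h15 L).lDeltaTheta) : (C.rigidData μ hC hS h15 L).PiX),
              (Subgroup.mem_inf.1 ((C.rigidData μ hC hS h15 L).lDeltaTheta_le hmem)).1⟩) ∈ T.envAtTheta.top),
          Sec.commutator (QuotientGroup.mk x : ↥C.Huu ⧸ (F.reconstruction e).inclY.range)
              (QuotientGroup.mk b : W.DeltaYell) =
            (QuotientGroup.mk (⟨_, hg⟩ : ↥T.envAtTheta.top) : T.envAtTheta.carrier)) ∧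
      -- `Φ.act` is conjugation, read through the model embedding; trivial on `Δ_C(M) = Ker(augC)`
      (∀ (c : W.PiC) (u v : ↥T.envAtTheta.top),
          (e (v : Menv.Pi)).left = galMuN p S.N (cl.augC (ω c)) (e (u : Menv.Pi)).left →
          ((((e (v : Menv.Pi)).right : ↥(C.rigidData μ hC hS h15 L).PiY) : ↥C.Huu) : Mt.PiTemp) =
            cl.conjX (ω c) ((((e (u : Menv.Pi)).right : ↥(C.rigidData μ hC hS h15 L).PiY) : ↥C.Huu) : Mt.PiTemp) →
          Φ.act c (QuotientGroup.mk u) = QuotientGroup.mk v) ∧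
      (∀ c : W.PiC, cl.augC (ω c) = 1 → Φ.act c = 1) ∧
      -- `Φ.actlZ` is conjugation on `(l·ℤ)(M)`, read through `toZ`
      (∀ (c : W.PiC) (x x' : ↥C.Huu),
          (QuotientGroup.mk x' : ↥C.Huu ⧸ (F.reconstruction e).inclY.range) =
            Φ.actlZ c (QuotientGroup.mk x : ↥C.Huu ⧸ (F.reconstruction e).inclY.range) →
          Mt.toZ (x' : Mt.PiTemp) = Mt.toZ (cl.conjX (ω c) (x : Mt.PiTemp))) ∧
      (∀ c : W.PiC, (ω c ∈ Mt.inclX.range → Φ.actlZ c = 1) ∧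
        (ω c ∉ Mt.inclX.range → ∀ a : (F.reconstruction e).lZ, Φ.actlZ c a = a⁻¹)) ∧
      -- `Φ.actEll` is conjugation on `Δ^ell_Y(M)`, read through `(Π^tp_X)^ell`
      (∀ (c : W.PiC) (b b' : ↥(F.reconstruction e).DeltaY),
        (QuotientGroup.mk b' : W.DeltaYell) = Φ.actEll c (QuotientGroup.mk b) →
        Mt.thetaToEll (Mt.toTheta (((b' : ↥(Mt.GtpY.subgroupOf C.Huu)) : ↥C.Huu) : Mt.PiTemp)) =
          Mt.thetaToEll (Mt.toTheta (cl.conjX (ω c) (((b : ↥(Mt.GtpY.subgroupOf C.Huu)) : ↥C.Huu) : Mt.PiTemp)))) := by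
  classical
  set R : RigidData S.N l := C.rigidData μ hC hS h15 L with hRdef
  /- ### §1. The genuine core tower, `Π_C(M)` identified with `Π^tp_C` (abc-iut-w4-d018's p466913, BY NAME) -/
  obtain ⟨W, j, hDeltaC, hjiso, hXbar, hX, -, hWker, hPiC, hN, hq⟩ :=
    exists_coreTower_pinned_of_cLevelData C μ hC hS h15 L F e cl hO hYcl hR1c
  /- ### §2. The pinned theta-quotient datum, two sections, and the three conjugation actions -/
  obtain ⟨T, Sec, -, hT, -, -, hP1, hP2, hP3⟩ :=
    exists_twoSections_pinned_of_coreTower C μ hC hS h15 L F e hO hYcl hη W hWker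
  obtain ⟨act, hpin, hex, hfac⟩ := exists_conjAct C μ hC hS h15 L F e cl hinv hO hYcl hker T hT
  obtain ⟨actlZ, hlZpin, hlZ1, hlZι⟩ := exists_conjActlZ C μ hC hS h15 L F e cl hR1c
  haveI hdYn : (W.kerEll.subgroupOf (F.reconstruction e).DeltaY).Normal := W.deltaEll_normal
  obtain ⟨actEll, hEll⟩ := exists_conjActEll C μ hC hS h15 L F e cl hR1c hO hYcl hker hl W hWker
  have hq' : Nonempty (W.DeltaC ⧸ W.DeltaXplain.subgroupOf W.DeltaC ≃* Literature.IUT.HodgeTheaters.FlPM S.l) := by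
    rw [hlS]; exact hq
  /- ### §3. Equivariance of the commutator map -/
  haveI hinclYn : (F.reconstruction e).inclY.range.Normal := (F.reconstruction e).inclY_normal
  have haugR : ∀ x : ↥C.Huu, x ∈ R.aug.ker ↔ Mt.aug (x : Mt.PiTemp) = 1 := fun x => by
    rw [MonoidHom.mem_ker, ← OneMemClass.coe_eq_one]; rfl
  have hΔY : ∀ y : ↥(F.reconstruction e).DeltaY,
      Mt.aug (((y : ↥(Mt.GtpY.subgroupOf C.Huu)) : ↥C.Huu) : Mt.PiTemp) = 1 := fun y =>
    (mem_deltaY_reconstruction_iff C μ hC hS h15 L F e y.1).1 y.2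
  have hxrep : ∀ a : (F.reconstruction e).lZ, ∃ x : ↥C.Huu,
      (QuotientGroup.mk x : ↥C.Huu ⧸ (F.reconstruction e).inclY.range) = a ∧ Mt.aug (x : Mt.PiTemp) = 1 := by
    intro a
    obtain ⟨x₀, rfl⟩ := QuotientGroup.mk_surjective a
    obtain ⟨y, hy⟩ := ModelCyclotomes.augY_surjective R (R.aug x₀)
    refine ⟨x₀ * (y : ↥C.Huu)⁻¹, ?_, ?_⟩
    · refine (QuotientGroup.eq.2 ?_).symm
      rw [← mul_assoc, inv_mul_cancel, one_mul]; exact inv_mem ⟨y, rfl⟩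
    · rw [← haugR, MonoidHom.mem_ker, map_mul, map_inv, mul_inv_eq_one]; exact hy.symm
  have htopA : ∀ g : ↥R.lDeltaTheta, e.symm (R.toThetaEnvData.sAlg
      ⟨(g : R.PiX), (Subgroup.mem_inf.1 (R.lDeltaTheta_le g.2)).1⟩) ∈ T.envAtTheta.top := by
    intro g
    change (((e (e.symm _)).right : ↥C.Huu)) ∈ R.lDeltaTheta
    rw [ContinuousMulEquiv.apply_symm_apply]
    exact g.2
  have hleftA : ∀ x : ↥R.PiYdd, (R.toThetaEnvData.sAlg x).left = 1 := fun _ => rfl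
  have hrightA : ∀ x : ↥R.PiYdd, (((R.toThetaEnvData.sAlg x).right : ↥C.Huu) : Mt.PiTemp) = ((x : R.PiX) : Mt.PiTemp) :=
    fun _ => rfl
  have hequiv : ∀ (c : W.PiC) (a : (F.reconstruction e).lZ) (y : W.DeltaYell),
      Sec.commutator (actlZ (j c) a) (actEll (j c) y) = act (j c) (Sec.commutator a y) := by
    intro c₀ a y
    set c : Mt.GtpC := j c₀ with hcdef
    obtain ⟨x, rfl, hx⟩ := hxrep a
    obtain ⟨b, rfl⟩ := QuotientGroup.mk_surjective y
    obtain ⟨x', hx'a, hx'⟩ := hxrep (actlZ c (QuotientGroup.mk x))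
    obtain ⟨b', hb'y⟩ := QuotientGroup.mk_surjective (actEll c (QuotientGroup.mk b : W.DeltaYell))
    rw [← hx'a, ← hb'y]
    -- both commutators through (P3)
    obtain ⟨hmem, hg, hcomm⟩ := hP3 x hx b
    obtain ⟨hmem', hg', hcomm'⟩ := hP3 x' hx' b'
    rw [hcomm, hcomm']
    -- the right-hand side through `conjAct_mk_sAlg`
    set g : ↥R.lDeltaTheta := ⟨_, hmem⟩ with hgdef
    set g' : ↥R.lDeltaTheta := ⟨_, hmem'⟩ with hg'def
    let g'' : ↥R.lDeltaTheta := ⟨⟨cl.conjX c ((g : ↥C.Huu) : Mt.PiTemp),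
        C.conjX_mem_Huu_of_mem_lDeltaTheta μ hC hS h15 L cl hker c _ g.2⟩,
      C.conjX_mem_lDeltaTheta μ hC hS h15 L cl hker c _ g.2⟩
    have hgg'' : ((g'' : ↥C.Huu) : Mt.PiTemp) = cl.conjX c ((g : ↥C.Huu) : Mt.PiTemp) := rfl
    rw [conjAct_mk_sAlg C μ hC hS h15 L F e cl T act hpin c g g'' hgg'' hg (htopA g'')]
    -- same class: same `μ_N`-coordinate (`1`) and same image in `(Π^tp_X)^Θ` (pairing lemma)
    apply envAtTheta_mk_eq_of_toTheta_eq C μ hC hS h15 L F e T hT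
    · change (e (e.symm _)).left = (e (e.symm _)).left
      rw [ContinuousMulEquiv.apply_symm_apply, ContinuousMulEquiv.apply_symm_apply, hleftA, hleftA]
    · change Mt.toTheta ((((e (e.symm _)).right : ↥R.PiY) : ↥C.Huu) : Mt.PiTemp) =
        Mt.toTheta ((((e (e.symm _)).right : ↥R.PiY) : ↥C.Huu) : Mt.PiTemp)
      rw [ContinuousMulEquiv.apply_symm_apply, ContinuousMulEquiv.apply_symm_apply, hrightA, hrightA, hgg'']
      -- unfold the two commutators as products in `Π^tp_X`
      have e1 : (((g' : ↥R.lDeltaTheta) : R.PiX) : Mt.PiTemp) =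
          (x' : Mt.PiTemp) * (((b' : ↥(Mt.GtpY.subgroupOf C.Huu)) : ↥C.Huu) : Mt.PiTemp) * (x' : Mt.PiTemp)⁻¹ *
            ((((b' : ↥(Mt.GtpY.subgroupOf C.Huu)) : ↥C.Huu) : Mt.PiTemp))⁻¹ := rfl
      have e2 : (((g : ↥R.lDeltaTheta) : R.PiX) : Mt.PiTemp) =
          (x : Mt.PiTemp) * (((b : ↥(Mt.GtpY.subgroupOf C.Huu)) : ↥C.Huu) : Mt.PiTemp) * (x : Mt.PiTemp)⁻¹ *
            ((((b : ↥(Mt.GtpY.subgroupOf C.Huu)) : ↥C.Huu) : Mt.PiTemp))⁻¹ := rfl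
      rw [e1, e2]
      have hb'Y : (((b' : ↥(Mt.GtpY.subgroupOf C.Huu)) : ↥C.Huu) : Mt.PiTemp) ∈ Mt.DtpY :=
        ⟨Subgroup.mem_subgroupOf.1 (b' : ↥(Mt.GtpY.subgroupOf C.Huu)).2, hΔY b'⟩
      have key := Mt.toThetaSetting.toTheta_conjComm_eq_of_toZ_eq_of_thetaToEll_eq hO hx'
        ((cl.conjX_mem_deltaTemp_iff c _).2 hx) (hlZpin c x x' hx'a) hb'Y (hEll c b b' hb'y)
      simp only [map_mul, map_inv] at key ⊢
      exact key
  /- ### §4. Assembly -/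
  refine ⟨W, T, Sec,
    { act := act.comp j.toMonoidHom
      act_factors := fun c hc => ?_
      abelian := envAtTheta_mul_comm F e T hT
      actlZ := actlZ.comp j.toMonoidHom
      actEll := actEll.comp j.toMonoidHom
      commutator_equivariant := fun c a y => hequiv c a y
      sTheta_stable := fun c =>
        sTheta_map_conjAct_eq C μ hC hS h15 L F e cl hinv hO hYcl hker T Sec hη hP1 act hpin (j c)
      sAlg_stable := fun c => sAlg_map_conjAct_eq C μ hC hS h15 L F e cl hker T hT Sec hP2 act hpin (j c)
      deltaX_normal := hN
      quot_iso_Fl := hq' },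
    j, hPiC, hWker, hjiso, hXbar, hX, hDeltaC, hT, hP3, fun c => hpin (j c), fun c hc => hfac (j c) hc,
    fun c => hlZpin (j c), fun c => ⟨hlZ1 (j c), hlZι (j c)⟩, fun c => hEll (j c)⟩
  -- `act_factors`: `Δ_C(M) = Ker(augC)` (through `j`) acts trivially
  rw [MonoidHom.mem_ker]
  exact hfac (j c) ((hDeltaC c).1 hc)

end ModelFrame

end Literature.IUT.HodgeArakelov

end
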